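import HarnessLib
import Summits.ValiantsHypothesis.Statement
import Summits.ValiantsHypothesis.ValiantsHypothesis.Theorems.ArithmeticDescent
import Summits.ValiantsHypothesis.ValiantsHypothesis.Theorems.ArithmeticDescentLefschetz
import Summits.ValiantsHypothesis.ValiantsHypothesis.Theorems.ArithmeticDescentPrimeReduction
import Summits.ValiantsHypothesis.ValiantsHypothesis.Theorems.SuccinctLiftFiniteFields
import Summits.ValiantsHypothesis.ValiantsHypothesis.Theorems.DepthWindowBinarisation

/-!
# ValiantsHypothesis / TauConst — ArithmeticDescent II: the PRIME NOTCH of the constants column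
# (reduction modulo primes; kernel), part 3/3: placement and the exact split

Decomposition workshop `decomp-valiant`, lens 2 (natural-proofs / succinctness axis), generation 13.
Generation 12 (`Theorems/ArithmeticDescent.lean`) cut Valiant's hypothesis along the field of
CONSTANTS, `VH ⟺ TauPerHard ∧ HeightLift ∧ Descent`, and typed — without placing it — a third
arithmetic reading of "explicitness", hardness of `per_n` over PRIME FIELDS:

* `PrimesIO`  — for every exponent `c`, infinitely many `n` admit infinitely many primes `p` with
  `L_{𝔽_p}(per_n) > n^c + c` ("i.o. primes");
* `PrimesAE`  — the same with "all but finitely many primes `p`" ("a.e. primes");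
* `CofiniteCharHard` — the same over ALL finite fields of large characteristic.

This file PLACES them (all arrows kernel-checked, no `sorry`):

  `VH ⟺ CofiniteCharHard ⟺ PrimesAE ⟹ PrimesIO ⟹ RatPerHard ⟹ TauPerHard`

(`cofiniteCharHard_iff_vh`: Lefschetz principle for fan-in-two complexity, from the tree's
`SuccinctLift.exists_complexCircuit_perPoly_of_charSpread` and `exists_finiteFieldConstants`, with the
new bookkeeping `productDepth_le_size`; `primesAE_iff_vh`: a `ℚ̄`-circuit reduces to `𝔽_p` at the
infinitely many SPLIT primes of the number field of its constants — Schur's theorem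
`Literature.NumberTheory.Sieve.schur_exists_prime_dvd_eval` applied to an integral primitive element,
localisation of the order `ℤ[θ]` at the denominators (`exists_zmodCircuit_of_numberFieldCircuit`);
`ratPerHard_of_primesIO`: reduction of a rational circuit modulo every prime not dividing a
denominator, through the local ring `ℤ_(p) ∩ ℚ`), and splits generation 12's residual
`Descent := RatPerHard → VH` EXACTLY at the prime notch:

  `Descent ⟺ HassePiece ∧ InertiaPiece`,  `HassePiece := RatPerHard → PrimesIO`,
  `InertiaPiece := PrimesIO → VH ⟺ (PrimesIO → PrimesAE)` (`inertiaPiece_iff_io_ae`),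

so that `VH ⟺ TauPerHard ∧ HeightLift ∧ HassePiece ∧ InertiaPiece` (`summit_iff_split_primes`),
and route `TauConst`'s item `TauConstElim` (stmt-ValiantsHypothesis-0335) factors as
`HeightLift ∧ HassePiece ∧ InertiaPiece` (`tauConstElim_iff_three`).

The names record the two arithmetic obstructions separating the notches: `HassePiece` is a
local-to-global statement (easiness over `𝔽_p` for almost all `p` ⟹ easiness over `ℚ` — false for
general zero-dimensional families, e.g. `(y²-2)(y²-3)(y²-6)` has a root modulo every prime and no
rational root, so it must use the permanent), `InertiaPiece` an inert-prime statement (hardness over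
`𝔽_p` for infinitely many `p` ⟹ hardness over all finite fields of large characteristic: a
polynomial-size circuit over `ℚ̄` reduces to `𝔽_p` only at primes of residue degree one, which have
density `1/[K:ℚ]` by Chebotarev/Frobenius, and `[K_n:ℚ]` is exactly generation 12's `DegreeDescent`).

HONEST FRAMING: nothing here is progress on `VP ≠ VNP`.  `CofiniteCharHard` and `PrimesAE` are
EQUIVALENT to the summit (costumes, certified as such in kernel); `PrimesIO` is implied by it and
implies `VP_ℚ ≠ VNP_ℚ`, and is not known to be equivalent to either; none of the four pieces is known
to imply the summit or to be refutable short of it.  The content is the exact placement — the residual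
irrationality statement `Descent` is PRECISELY "infinitely many primes ⟹ almost all primes" for the
hardness of `per_n` over prime fields, plus a Hasse-type statement — and the exact factorisation of an
existing item, in kernel.
-/

noncomputable section
set_option linter.dupNamespace false

open MvPolynomial
open Literature.Computability.AlgebraicComplexity

namespace Summit.ValiantsHypothesis.ValiantsHypothesis.Theorems.ArithmeticDescent

/-! ### §2 The prime-field notches -/

/-- notch · WEAKER-or-EQUAL (S ⟹ it, kernel `primesIO_of_vh`; it ⟹ `RatPerHard`, kernel
`ratPerHard_of_primesIO`; converse to S = `InertiaPiece`, open).  Typed verbatim as in generation 12.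
For every exponent `c` there are arbitrarily large `n` and, for each, INFINITELY MANY primes `p` with
`L_{𝔽_p}(per_n) > n^c + c`. (ref: Burgisser2000, §4.1; Valiant 1979 — `per` is #P-hard mod `p ≠ 2`) -/
def PrimesIO : Prop :=
  ∀ c n₀ : ℕ, ∃ n, n₀ ≤ n ∧ ∀ p₀ : ℕ, ∃ p, p₀ ≤ p ∧ p.Prime ∧
    n ^ c + c < complexity (perPoly (Fin n) (ZMod p))

/-- notch · COSTUME (EQUIVALENT to S, kernel `primesAE_iff_vh`): for every `c`, arbitrarily large `n`
with `L_{𝔽_p}(per_n) > n^c + c` for ALL BUT FINITELY MANY primes `p`.  S ⟹ it by Lefschetz; it ⟹ S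
because a `ℚ̄`-circuit reduces modulo the infinitely many split primes of the number field of its
constants (Schur: `Literature.NumberTheory.Sieve.schur_exists_prime_dvd_eval`). (ref: Burgisser2000, §4.1) -/
def PrimesAE : Prop :=
  ∀ c n₀ : ℕ, ∃ n, n₀ ≤ n ∧ ∃ p₀ : ℕ, ∀ p, p₀ ≤ p → p.Prime →
    n ^ c + c < complexity (perPoly (Fin n) (ZMod p))

/-- notch · COSTUME (EQUIVALENT to S, kernel `cofiniteCharHard_iff_vh`): for every `c`, arbitrarily
large `n` and some `N ≠ 0` with `L_F(per_n) > n^c + c` for EVERY finite field `F` in which `N ≠ 0`.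
Recorded as the finite-field form of `PrimesAE` (`primesAE_iff_cofiniteCharHard`).
(ref: Burgisser2000, §4.1; BurgisserClausenShokrollahi1997, Thm. (4.17)) -/
def CofiniteCharHard : Prop :=
  ∀ c n₀ : ℕ, ∃ n, n₀ ≤ n ∧ ∃ N : ℕ, N ≠ 0 ∧ ∀ (F : Type) [Field F] [Fintype F], (N : F) ≠ 0 →
    n ^ c + c < complexity (perPoly (Fin n) F)

/-- crux · DECLARED RESIDUAL factor 2a (local-to-global / Hasse) · IDEA-NEEDED.
`VP_ℚ ≠ VNP_ℚ ⟹ PrimesIO`: contrapositively, if for all large `n` the permanent is easy modulo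
ALMOST EVERY prime at a fixed polynomial budget, then it is easy over `ℚ`.  Why it might fail: the
cheap `𝔽_p`-circuits may vary with `p` with no common rational lift (Hasse fails for zero-dimensional
families: `(y²-2)(y²-3)(y²-6)`); a lift by CRT/rational reconstruction needs height control = `HeightLift`.
(ref: Burgisser2000, §4.1 and §4.3 (GRH transfer)) -/
def HassePiece : Prop := RatPerHard → PrimesIO

/-- crux · DECLARED RESIDUAL factor 2b (inert primes / Frobenius) · IDEA-NEEDED.
`PrimesIO ⟹ VH`, equivalently (kernel `inertiaPiece_iff_io_ae`) `PrimesIO → PrimesAE`: hardness of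
`per_n` modulo infinitely many primes upgrades to hardness modulo almost all primes.
Why it might fail: optimal circuits over `ℚ̄` live in number fields `K_n`; they reduce to `𝔽_p` only
at the density-`1/[K_n:ℚ]` set of split primes, so i.o.-prime hardness is compatible with `per ∈ VP_ℚ̄`
unless `[K_n:ℚ]` is controlled (= generation 12's `DegreeDescent`). (ref: BurgisserClausenShokrollahi1997, Ex. 4.5) -/
def InertiaPiece : Prop := PrimesIO → ValiantsHypothesis

/-- The node's deciding implication (`closes`): the four pieces give the summit. [folklore] -/
theorem vh_of_pieces_primes (hT : TauPerHard) (hH : HeightLift) (hHa : HassePiece)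
    (hI : InertiaPiece) : ValiantsHypothesis :=
  hI (hHa (hH hT))

/-! ### §3 Down the column from the summit (Lefschetz) -/

/-- `VH ⟹ CofiniteCharHard`. [cite: Burgisser2000, §4.1] -/
theorem cofiniteCharHard_of_vh (h : ValiantsHypothesis) : CofiniteCharHard := by
  intro c n₀
  have ht : ¬ IsPBounded fun n => complexity (perPoly (Fin n) ℂ) := vh_iff_perHard.mp h
  obtain ⟨n, hn, hlt⟩ := exists_ge_lt_of_not_isPBounded ht 4 c n₀
  refine ⟨n, hn, ?_⟩
  by_contra hc
  push Not at hc
  have hle := complexity_perPoly_complex_le_of_charSpread n (n ^ c + c) fun N hN => by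
    obtain ⟨F, iF, _, hNF, hle⟩ := hc N hN
    exact ⟨F, iF, hNF, hle⟩
  omega

/-- `CofiniteCharHard ⟹ VH`: a polynomial-size `ℂ`-circuit for `per_n` has, for every `N ≠ 0`, a
twin of the same size over a finite field with `N ≠ 0` (tree `exists_finiteFieldConstants`). [cite: Burgisser2000, §4.1] -/
theorem vh_of_cofiniteCharHard (h : CofiniteCharHard) : ValiantsHypothesis := by
  by_contra hV
  rw [vh_iff_perHard, not_not] at hV
  obtain ⟨c, hc⟩ := hV
  have h1 : IsPBounded (fun n : ℕ => n ^ c + c) := ⟨c, fun _ => le_rfl⟩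
  obtain ⟨c', hc'⟩ : IsPBounded fun n => 4 * (n ^ c + c) :=
    IsPBounded.mul_holds (IsPBounded.const 4) h1
  obtain ⟨n, -, N, hN, hF⟩ := h c' 0
  obtain ⟨C, h2, hCc, hCs⟩ :=
    ArithCircuit.exists_computes_size_eq_complexity (perPoly (Fin n) ℂ)
  obtain ⟨F, iF, iFin, hNF, C', hC'c, -, hC'e, hC's⟩ :=
    SuccinctLift.exists_finiteFieldConstants C (perPoly (Fin n) ℤ) (by rwa [map_perPoly]) N hN
  have hlt := hF F hNF
  rw [map_perPoly, ArithCircuit.Computes] at hC'c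
  have hcn := hc n
  have hc'n := hc' n
  dsimp only at hcn hc'n
  have hE : C.edgeSize ≤ 2 * C.size := ArithCircuit.edgeSize_le_two_mul_size_holds h2
  have : complexity (perPoly (Fin n) F) ≤ 2 * C'.edgeSize := by
    rw [← hC'c]; exact DepthWindow.complexity_eval_le_two_mul_edgeSize C'
  omega

/-- **The cofinite-characteristic notch is the summit in costume.** [cite: Burgisser2000, §4.1] -/
theorem cofiniteCharHard_iff_vh : CofiniteCharHard ↔ ValiantsHypothesis :=
  ⟨vh_of_cofiniteCharHard, cofiniteCharHard_of_vh⟩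

/-- `CofiniteCharHard ⟹ PrimesAE` (prime fields are finite fields). [folklore] -/
theorem primesAE_of_cofiniteCharHard (h : CofiniteCharHard) : PrimesAE := by
  intro c n₀
  obtain ⟨n, hn, N, hN, hF⟩ := h c n₀
  refine ⟨n, hn, N + 1, fun p hp hprime => ?_⟩
  haveI : Fact p.Prime := ⟨hprime⟩
  have hNp : (N : ZMod p) ≠ 0 := by
    rw [Ne, ZMod.natCast_eq_zero_iff]
    exact Nat.not_dvd_of_pos_of_lt (Nat.pos_of_ne_zero hN) (Nat.lt_of_succ_le hp)
  exact hF (ZMod p) hNp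

/-- `PrimesAE ⟹ PrimesIO` (there are infinitely many primes). [folklore] -/
theorem primesIO_of_primesAE (h : PrimesAE) : PrimesIO := by
  intro c n₀
  obtain ⟨n, hn, p₀, hp₀⟩ := h c n₀
  refine ⟨n, hn, fun p₁ => ?_⟩
  obtain ⟨p, hp, hprime⟩ := Nat.exists_infinite_primes (max p₀ p₁)
  exact ⟨p, (le_max_right _ _).trans hp, hprime, hp₀ p ((le_max_left _ _).trans hp) hprime⟩

/-- `VH ⟹ PrimesAE`. [cite: Burgisser2000, §4.1] -/
theorem primesAE_of_vh (h : ValiantsHypothesis) : PrimesAE :=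
  primesAE_of_cofiniteCharHard (cofiniteCharHard_of_vh h)

/-- `VH ⟹ PrimesIO`. [cite: Burgisser2000, §4.1] -/
theorem primesIO_of_vh (h : ValiantsHypothesis) : PrimesIO :=
  primesIO_of_primesAE (primesAE_of_vh h)

/-! ### §4 Up the column from the prime notches -/

/-- **`PrimesIO ⟹ VP_ℚ ≠ VNP_ℚ`**: a polynomial-size rational circuit for `per_n` reduces to a
polynomial-size `𝔽_p`-circuit for every prime `p` beyond its denominators. [cite: Burgisser2000, §4.1] -/
theorem ratPerHard_of_primesIO (h : PrimesIO) : RatPerHard := by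
  intro hQ
  obtain ⟨c, hc⟩ := hQ
  obtain ⟨n, -, hn⟩ := h c 0
  obtain ⟨Q, h2, hQc, hQs⟩ :=
    ArithCircuit.exists_computes_size_eq_complexity (perPoly (Fin n) ℚ)
  obtain ⟨p₀, hp₀⟩ := exists_zmodCircuit_of_ratCircuit Q (perPoly (Fin n) ℤ) (by rwa [map_perPoly])
  obtain ⟨p, hp, hprime, hlt⟩ := hn p₀
  obtain ⟨Q', hQ'c, hQ's, hQ'2⟩ := hp₀ p hp hprime
  rw [map_perPoly] at hQ'c
  have h1 := ArithCircuit.complexity_le_size (hQ'2 h2) hQ'c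
  have h3 := hc n
  dsimp only at h3
  omega

/-- Hence `PrimesIO ⟹ TauPerHard`. [cite: Burgisser2000, §4.1] -/
theorem tauPerHard_of_primesIO (h : PrimesIO) : TauPerHard :=
  tauPerHard_of_ratPerHard (ratPerHard_of_primesIO h)

/-- **The prime notch is a notch**: `VH ⟹ PrimesIO ⟹ VP_ℚ ≠ VNP_ℚ`. [cite: Burgisser2000, §4.1] -/
theorem primesIO_sandwich : (ValiantsHypothesis → PrimesIO) ∧ (PrimesIO → RatPerHard) :=
  ⟨primesIO_of_vh, ratPerHard_of_primesIO⟩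

/-- **`PrimesAE ⟹ VH`**: if `per ∈ VP_ℂ` then `per ∈ VP_ℚ̄` (autarky, generation 12's
`vh_iff_algPerHard`), and a polynomial-size `ℚ̄`-circuit for `per_n` reduces to `𝔽_p` at infinitely
many (split) primes `p` — so `per_n` is easy modulo infinitely many primes, for every `n`.
[cite: BurgisserClausenShokrollahi1997, Thm. (4.17)(2)] -/
theorem vh_of_primesAE (h : PrimesAE) : ValiantsHypothesis := by
  by_contra hV
  rw [vh_iff_algPerHard] at hV
  unfold AlgPerHard at hV
  rw [not_not] at hV
  obtain ⟨c, hc⟩ := hV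
  obtain ⟨n, -, p₀, hp₀⟩ := h c 0
  obtain ⟨Q, h2, hQc, hQs⟩ :=
    ArithCircuit.exists_computes_size_eq_complexity (perPoly (Fin n) (AlgebraicClosure ℚ))
  obtain ⟨p, hprime, hp, Q', hQ'c, hQ's, hQ'2⟩ :=
    exists_zmodCircuit_of_algCircuit Q (perPoly (Fin n) ℤ) (by rwa [map_perPoly]) p₀
  rw [map_perPoly] at hQ'c
  have h1 := ArithCircuit.complexity_le_size (hQ'2 h2) hQ'c
  have hlt := hp₀ p hp.le hprime
  have h3 := hc n
  dsimp only at h3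
  omega

/-- **The "almost every prime" notch is the summit in costume** (kernel): `PrimesAE ⟺ VH`.
[cite: Burgisser2000, §4.1] -/
theorem primesAE_iff_vh : PrimesAE ↔ ValiantsHypothesis :=
  ⟨vh_of_primesAE, primesAE_of_vh⟩

/-- Hence also `PrimesAE ⟺ CofiniteCharHard`: over prime fields or over all finite fields of large
characteristic, almost-everywhere hardness is the same statement. [cite: Burgisser2000, §4.1] -/
theorem primesAE_iff_cofiniteCharHard : PrimesAE ↔ CofiniteCharHard := by
  rw [primesAE_iff_vh, cofiniteCharHard_iff_vh]

/-! ### §5 The exact split of `Descent` at the prime notch -/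

/-- `Descent ⟹ HassePiece`. [folklore] -/
theorem hassePiece_of_descent (hD : Descent) : HassePiece := fun hR => primesIO_of_vh (hD hR)

/-- `Descent ⟹ InertiaPiece`. [folklore] -/
theorem inertiaPiece_of_descent (hD : Descent) : InertiaPiece := fun hI =>
  hD (ratPerHard_of_primesIO hI)

/-- `HassePiece ∧ InertiaPiece ⟹ Descent`. [folklore] -/
theorem descent_of_hasse_of_inertia (hHa : HassePiece) (hI : InertiaPiece) : Descent := fun hR =>
  hI (hHa hR)

/-- **Exact split of generation 12's residual `Descent` at the prime notch.** [folklore] -/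
theorem descent_iff_hasse_and_inertia : Descent ↔ HassePiece ∧ InertiaPiece :=
  ⟨fun hD => ⟨hassePiece_of_descent hD, inertiaPiece_of_descent hD⟩,
    fun h => descent_of_hasse_of_inertia h.1 h.2⟩

/-- The pieces are implied by the summit (necessity). [folklore] -/
theorem hassePiece_of_vh (h : ValiantsHypothesis) : HassePiece := fun _ => primesIO_of_vh h

/-- The pieces are implied by the summit (necessity). [folklore] -/
theorem inertiaPiece_of_vh (h : ValiantsHypothesis) : InertiaPiece := fun _ => h

/-- `InertiaPiece` is exactly the inert-prime gap `PrimesIO → CofiniteCharHard`. [cite: Burgisser2000, §4.1] -/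
theorem inertiaPiece_iff : InertiaPiece ↔ (PrimesIO → CofiniteCharHard) := by
  simp only [InertiaPiece, cofiniteCharHard_iff_vh]

/-- **`InertiaPiece` is exactly the passage from infinitely many to almost all primes**:
`(PrimesIO → VH) ⟺ (PrimesIO → PrimesAE)`. [cite: Burgisser2000, §4.1] -/
theorem inertiaPiece_iff_io_ae : InertiaPiece ↔ (PrimesIO → PrimesAE) := by
  simp only [InertiaPiece, primesAE_iff_vh]

/-- `HassePiece` is exactly `VP_ℚ ≠ VNP_ℚ → PrimesIO`; in "a.e. primes" dress `RatPerHard → PrimesAE`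
it would be the whole of `Descent` (`primesAE_iff_vh`).  The i.o. form is implied by the a.e. form. [folklore] -/
theorem hassePiece_of_ae (h : RatPerHard → PrimesAE) : HassePiece := fun hR =>
  primesIO_of_primesAE (h hR)

/-- **The generation-13 node**: `VH ⟺ TauPerHard ∧ HeightLift ∧ HassePiece ∧ InertiaPiece`. [folklore] -/
theorem summit_iff_split_primes :
    ValiantsHypothesis ↔ TauPerHard ∧ HeightLift ∧ HassePiece ∧ InertiaPiece := by
  rw [summit_iff_split, descent_iff_hasse_and_inertia]

/-- Route `TauConst`'s item `TauConstElim` (stmt-ValiantsHypothesis-0335) factors through the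
rational AND the prime notch: heights ∧ Hasse ∧ inertia. [folklore] -/
theorem tauConstElim_iff_three :
    Summit.ValiantsHypothesis.ValiantsHypothesis.Theses.TauConst.TauConstElim ↔
      HeightLift ∧ HassePiece ∧ InertiaPiece := by
  rw [← residual_iff_tauConstElim, descent_iff_hasse_and_inertia]

end Summit.ValiantsHypothesis.ValiantsHypothesis.Theorems.ArithmeticDescent

end
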